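import Literature.MathematicalPhysics.KineticTheory.HardSphereEulerLLN
import Summits.AtomisticToContinuum.HydrodynamicLimit.Theorems.PolynomialCompression.Negative.PdeForm
import HarnessLib

/-!
# The `t = 0` LLN clause identifies the Euler data (stub `initialTemperature`)

Supporting file of the line `Sketch` (card `adiabat-pricing-of-the-ceiling`) for the crux
`AprioriBounds` (stmt-AtomisticToContinuum-14827), proving the registered stub
`stub_initialTemperature` of the lead's skeleton VERBATIM: if a classical hard-sphere Euler
solution `(ρ, u, θ)` on `[0, T)`, `T > 0`, is tied to the local Gibbs laws with profiles
`(a₀, u₀, θ₀)` by the `t = 0` clause `TendstoHydroFieldsAt … ρ u θ 0` (`HardSphereEuler.lean`)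
through ONE flow family `Φ`, and `σ < σ₀ := min σ_LLN(a₀, θ₀, u₀) (1/2)` with `σ_LLN` the
threshold of the PROVED law of large numbers `localGibbs_lln_holds` (`HardSphereEulerLLN.lean`),
then `θ(0, ·) = θ₀` and `u(0, ·) = u₀`.

## Proof

The tie through any flow family is the FLOW-FREE tie of the time-`0` slices
(`PolynomialCompressionPDE.tendstoHydroFieldsAt_zero_iff_flowFree`, from
`localGibbsLaw_preimage_flow_zero`: `Φ_0 = id` a.e.).  The LLN hands a continuous positive `ρ₀`
whose constant-in-time fields `(ρ₀, u₀, θ₀)` are tied through the same `Φ`, hence flow-freely.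
Under the flow-free local Gibbs MEASURES — probability measures for `σ ≤ 1/2`
(`isProbabilityMeasure_localGibbsMeasure`) — limits in probability are unique, and two continuous
functions on `𝕋³` with equal integrals against all continuous test functions coincide; this is
the landed DATA PINNING `PolynomialCompressionPDE.data_eq_of_flowFree`
(`Theorems/PolynomialCompression/Negative/PdeForm.lean`): `ρ(0) = ρ₀`, `u(0) = u₀` (cancel
`ρ₀ > 0` coordinatewise), `θ(0) = θ₀` (cancel `ρ₀ > 0` in `ρ₀(|u₀|²/2 + 3θ/2)`).  Continuity of
the time-`0` slices of the classical solution: `PolynomialCompressionPDE.continuous_slices_zero`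
(`Torus.IsSmoothSpaceTimeOn.isSmooth_slice` at `0 ∈ [0, T)`).

No new definitions, no named facts, no helper lemmas; axioms `propext`, `Classical.choice`,
`Quot.sound`.
-/

noncomputable section

open MeasureTheory Filter Set Topology
open scoped ENNReal ContDiff

namespace Summit.AtomisticToContinuum.HydrodynamicLimit.Theorems.AdiabatCeiling

open Literature.MathematicalPhysics.KineticTheory Literature.Analysis.FluidPDE
open Literature.Analysis.FunctionSpaces
open PolynomialCompressionPDE (tendstoHydroFieldsAt_zero_iff_flowFree data_eq_of_flowFree
  continuous_slices_zero)

/-- STUB `initialTemperature` of the line `Sketch` (crux `AprioriBounds`,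
stmt-AtomisticToContinuum-14827): the `t = 0` LLN clause IDENTIFIES the Euler data's temperature
and velocity with the profiles.  For `σ < σ₀ := min σ_LLN (1/2)`, `σ_LLN(a₀, θ₀, u₀)` the threshold
of the proved law of large numbers `localGibbs_lln_holds`, the empirical fields at time `0`
converge in probability under the local Gibbs laws to those of `(ρ₀, u₀, θ₀)` (`ρ₀ > 0`
continuous); by hypothesis they also converge to those of `(ρ, u, θ)(0, ·)` (continuous slices of
the classical solution, `T > 0`); both ties are flow-free
(`tendstoHydroFieldsAt_zero_iff_flowFree`) and limits in probability under the probability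
measures `localGibbsMeasure` (`σ ≤ 1/2`) are unique, so `θ(0, ·) = θ₀` and `u(0, ·) = u₀`
(`PolynomialCompressionPDE.data_eq_of_flowFree`). -/
theorem stub_initialTemperature :
    ∀ (a₀ θ₀ : T3 → ℝ) (u₀ : T3 → V3), Continuous a₀ → Continuous θ₀ → Continuous u₀ →
      (∀ x, 0 < a₀ x) → (∀ x, 0 < θ₀ x) →
      ∃ σ₀ : ℝ, 0 < σ₀ ∧ ∀ σ : ℝ, 0 < σ → σ < σ₀ →
        ∀ (T : ℝ) (ρ θ : ℝ → T3 → ℝ) (u : ℝ → T3 → V3), IsHardSphereEulerSolution σ T ρ u θ → 0 < T →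
        ∀ Φ : (N : ℕ) → HardSphereFlow (Torus.geometry (Fin 3)) (hsDiameter σ N) (N + 1),
          TendstoHydroFieldsAt (fun N => localGibbsLaw σ a₀ u₀ θ₀ N (Φ N)) Φ ρ u θ 0 →
          ∀ x : T3, θ 0 x = θ₀ x ∧ u 0 x = u₀ x := by
  intro a₀ θ₀ u₀ ha hθ hu ha0 hθ0
  obtain ⟨σ₁, hσ₁, H⟩ := localGibbs_lln_holds a₀ θ₀ u₀ ha hθ hu ha0 hθ0
  refine ⟨min σ₁ (1 / 2), lt_min hσ₁ (by norm_num), fun σ hσ hσlt T ρ θ u hsol hT Φ hTie x => ?_⟩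
  have hσσ₁ : σ < σ₁ := hσlt.trans_le (min_le_left _ _)
  have hσ2 : σ ≤ 1 / 2 := (hσlt.trans_le (min_le_right _ _)).le
  obtain ⟨ρ₀, hρ₀c, hρ₀pos, HΦ⟩ := H σ hσ hσσ₁
  obtain ⟨hρc, huc, hθc⟩ := continuous_slices_zero hsol hT
  -- both ties, made flow-free (the slices `(fun _ => c) 0` beta-reduce on instantiation)
  have hlln := (tendstoHydroFieldsAt_zero_iff_flowFree Φ).1 (HΦ Φ).2
  have ht := (tendstoHydroFieldsAt_zero_iff_flowFree Φ).1 hTie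
  obtain ⟨-, hu', hθ'⟩ :=
    data_eq_of_flowFree ha hθ hu ha0 hθ0 hσ2 hρ₀c hρ₀pos hlln hρc huc hθc ht
  exact ⟨congrFun hθ' x, congrFun hu' x⟩

end Summit.AtomisticToContinuum.HydrodynamicLimit.Theorems.AdiabatCeiling

end
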